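import Summits.Ventures.PercRepro.StarGadgetPurePairG
import Summits.Ventures.PercRepro.StarGadgetPurePairS0P0N2B
import Summits.Ventures.PercRepro.StarGadgetPurePairS0P1
import Summits.Ventures.PercRepro.StarGadgetPurePairS0P2
import Summits.Ventures.PercRepro.StarGadgetPurePairS0P3
import Summits.Ventures.PercRepro.StarGadgetPurePairS0P4Q0
import Summits.Ventures.PercRepro.StarGadgetPurePairS0P4Q1B
import Summits.Ventures.PercRepro.StarGadgetPurePairSposN0B
import Summits.Ventures.PercRepro.StarGadgetPurePairSposP0Q0
import Summits.Ventures.PercRepro.StarGadgetPurePairSposP0Q1A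
import Summits.Ventures.PercRepro.StarGadgetPurePairSposP1A
import Summits.Ventures.PercRepro.StarGadgetPurePairSposP1B

/-!
# **`G ≥ 0` on `ℕ⁵`**: the slice `s = 0` (node n2: the assemblies n15 / n17 and the splits on `p`), the slice `s ≥ 1, n ≥ 1, p = 0` (node n30: direction `n` + assembly; the split n24 on `q`), the assembly of n31, the splits n23 / n21, the root n1, and `G_nonneg`

One module of the exact certificate tree for `G` (data/mine-3/g20/single-p2.json, key `P[xc|xc]|cx=1`; one lemma per node:
half-space domination certificates, finite boxes, case splits `x = 0 / x ≥ 1`). The definition of `G` is in `StarGadgetPurePairG`;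
the theorem `G_nonneg` is in `StarGadgetPurePairNonneg`. A factor `(0:ℤ)^x` is the indicator `[x = 0]`.
-/

namespace PercRepro.StarGadget

/-- Node n15 of the certificate tree (half-space node): `0 ≤ G 2 q r 0 n` — the half-spaces `q ≥ 2`, `r ≥ 2`, `n ≥ 2` (direction lemmas `G_n15_d*`) and the remaining finite box by `interval_cases` + `norm_num [G]`. -/
theorem G_n15 (q r n : ℕ) : 0 ≤ G (0 + 1 + 1) q r 0 n := by
  by_cases hq : 2 ≤ q
  · obtain ⟨q, rfl⟩ := Nat.exists_eq_add_of_le' hq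
    exact G_n15_dq q r n
  by_cases hr : 2 ≤ r
  · obtain ⟨r, rfl⟩ := Nat.exists_eq_add_of_le' hr
    exact G_n15_dr q r n
  by_cases hn : 2 ≤ n
  · obtain ⟨n, rfl⟩ := Nat.exists_eq_add_of_le' hn
    exact G_n15_dn q r n
  push Not at hq hr hn
  interval_cases q <;> interval_cases r <;> interval_cases n <;> norm_num [G]

/-- Node n17 of the certificate tree (half-space node): `0 ≤ G 3 q r 0 n` — the half-spaces `q ≥ 2`, `r ≥ 2`, `n ≥ 2` (direction lemmas `G_n17_d*`) and the remaining finite box by `interval_cases` + `norm_num [G]`. -/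
theorem G_n17 (q r n : ℕ) : 0 ≤ G (0 + 1 + 1 + 1) q r 0 n := by
  by_cases hq : 2 ≤ q
  · obtain ⟨q, rfl⟩ := Nat.exists_eq_add_of_le' hq
    exact G_n17_dq q r n
  by_cases hr : 2 ≤ r
  · obtain ⟨r, rfl⟩ := Nat.exists_eq_add_of_le' hr
    exact G_n17_dr q r n
  by_cases hn : 2 ≤ n
  · obtain ⟨n, rfl⟩ := Nat.exists_eq_add_of_le' hn
    exact G_n17_dn q r n
  push Not at hq hr hn
  interval_cases q <;> interval_cases r <;> interval_cases n <;> norm_num [G]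

/-- Node n18 of the certificate tree (case split on `q`): `0 ≤ G (p + 4) q r 0 n` — `q = 0` by `G_n19`, `q ≥ 1` by `G_n20`. -/
theorem G_n18 (p q r n : ℕ) : 0 ≤ G (p + 1 + 1 + 1 + 1) q r 0 n := by
  rcases Nat.eq_zero_or_pos q with h | h
  · subst h
    exact G_n19 p r n
  · obtain ⟨q, rfl⟩ := Nat.exists_eq_add_of_le' h
    exact G_n20 p q r n

/-- Node n16 of the certificate tree (case split on `p`): `0 ≤ G (p + 3) q r 0 n` — `p = 0` by `G_n17`, `p ≥ 1` by `G_n18`. -/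
theorem G_n16 (p q r n : ℕ) : 0 ≤ G (p + 1 + 1 + 1) q r 0 n := by
  rcases Nat.eq_zero_or_pos p with h | h
  · subst h
    exact G_n17 q r n
  · obtain ⟨p, rfl⟩ := Nat.exists_eq_add_of_le' h
    exact G_n18 p q r n

/-- Node n14 of the certificate tree (case split on `p`): `0 ≤ G (p + 2) q r 0 n` — `p = 0` by `G_n15`, `p ≥ 1` by `G_n16`. -/
theorem G_n14 (p q r n : ℕ) : 0 ≤ G (p + 1 + 1) q r 0 n := by
  rcases Nat.eq_zero_or_pos p with h | h
  · subst h
    exact G_n15 q r n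
  · obtain ⟨p, rfl⟩ := Nat.exists_eq_add_of_le' h
    exact G_n16 p q r n

/-- Node n12 of the certificate tree (case split on `p`): `0 ≤ G (p + 1) q r 0 n` — `p = 0` by `G_n13`, `p ≥ 1` by `G_n14`. -/
theorem G_n12 (p q r n : ℕ) : 0 ≤ G (p + 1) q r 0 n := by
  rcases Nat.eq_zero_or_pos p with h | h
  · subst h
    exact G_n13 q r n
  · obtain ⟨p, rfl⟩ := Nat.exists_eq_add_of_le' h
    exact G_n14 p q r n

/-- Node n2 of the certificate tree (case split on `p`): `0 ≤ G p q r 0 n` — `p = 0` by `G_n3`, `p ≥ 1` by `G_n12`. -/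
theorem G_n2 (p q r n : ℕ) : 0 ≤ G p q r 0 n := by
  rcases Nat.eq_zero_or_pos p with h | h
  · subst h
    exact G_n3 q r n
  · obtain ⟨p, rfl⟩ := Nat.exists_eq_add_of_le' h
    exact G_n12 p q r n

/-- Half-space lemma of node n30 of the certificate tree (parent `G_n30`: `0 ≤ G 0 (q + 1) r (s + 1) (n + 1)`), direction `n` (the half-space `n ≥ 1` of the parent's variable): `0 ≤ G 0 (q + 1) r (s + 1) (n + 2)` — the exact domination certificate of record (data/mine-3/g20/single-p2.json, key `P[xc|xc]|cx=1`, node n30, direction n, N = 1): coordinatewise base monotonicity of the dominated monomials, positivity, `linarith`. -/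
theorem G_n30_dn (q r s n : ℕ) : 0 ≤ G 0 (q + 1) r (s + 1) (n + 1 + 1) := by
  have h0 : (4:ℤ)^q * 4^r * 5^s * 16^n ≤ (5:ℤ)^q * 4^r * 6^s * 16^n := by
    have := show (4:ℤ)^q * 4^r * 5^s * 16^n ≤ (5:ℤ)^q * 4^r * 6^s * 16^n by
      gcongr
      all_goals norm_num
    simpa using this
  have h1 : (4:ℤ)^q * 4^r * 5^s * 16^n ≤ (4:ℤ)^q * 5^r * 6^s * 16^n := by
    have := show (4:ℤ)^q * 4^r * 5^s * 16^n ≤ (4:ℤ)^q * 5^r * 6^s * 16^n by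
      gcongr
      all_goals norm_num
    simpa using this
  have h2 : (2:ℤ)^q * 2^r * 32^n ≤ (5:ℤ)^q * 2^r * 2^s * 32^n := by
    have := show (2:ℤ)^q * 2^r * 1^s * 32^n ≤ (5:ℤ)^q * 2^r * 2^s * 32^n by
      gcongr
      all_goals norm_num
    simpa using this
  have h3 : (2:ℤ)^q * 5^r * 3^s * 32^n ≤ (5:ℤ)^q * 5^r * 6^s * 32^n := by
    have := show (2:ℤ)^q * 5^r * 3^s * 32^n ≤ (5:ℤ)^q * 5^r * 6^s * 32^n by
      gcongr
      all_goals norm_num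
    simpa using this
  have h4 : (2:ℤ)^q * 4^r * 3^s * 16^n ≤ (3:ℤ)^q * 4^r * 4^s * 16^n := by
    have := show (2:ℤ)^q * 4^r * 3^s * 16^n ≤ (3:ℤ)^q * 4^r * 4^s * 16^n by
      gcongr
      all_goals norm_num
    simpa using this
  have h5 : (2:ℤ)^q * 4^r * 3^s * 16^n ≤ (2:ℤ)^q * 5^r * 4^s * 16^n := by
    have := show (2:ℤ)^q * 4^r * 3^s * 16^n ≤ (2:ℤ)^q * 5^r * 4^s * 16^n by
      gcongr
      all_goals norm_num
    simpa using this
  have h6 : (5:ℤ)^q * 2^r * 3^s * 32^n ≤ (5:ℤ)^q * 5^r * 6^s * 32^n := by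
    have := show (5:ℤ)^q * 2^r * 3^s * 32^n ≤ (5:ℤ)^q * 5^r * 6^s * 32^n by
      gcongr
      all_goals norm_num
    simpa using this
  have h7 : (4:ℤ)^q * 2^r * 3^s * 16^n ≤ (4:ℤ)^q * 3^r * 4^s * 16^n := by
    have := show (4:ℤ)^q * 2^r * 3^s * 16^n ≤ (4:ℤ)^q * 3^r * 4^s * 16^n by
      gcongr
      all_goals norm_num
    simpa using this
  have h8 : (4:ℤ)^q * 2^r * 3^s * 16^n ≤ (5:ℤ)^q * 2^r * 4^s * 16^n := by
    have := show (4:ℤ)^q * 2^r * 3^s * 16^n ≤ (5:ℤ)^q * 2^r * 4^s * 16^n by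
      gcongr
      all_goals norm_num
    simpa using this
  have h9 : (5:ℤ)^q * 3^r * 5^s * 16^n ≤ (5:ℤ)^q * 5^r * 6^s * 32^n := by
    have := show (5:ℤ)^q * 3^r * 5^s * 16^n ≤ (5:ℤ)^q * 5^r * 6^s * 32^n by
      gcongr
      all_goals norm_num
    simpa using this
  have h10 : (5:ℤ)^q * 3^r * 5^s * 16^n ≤ (5:ℤ)^q * 4^r * 6^s * 16^n := by
    have := show (5:ℤ)^q * 3^r * 5^s * 16^n ≤ (5:ℤ)^q * 4^r * 6^s * 16^n by
      gcongr
      all_goals norm_num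
    simpa using this
  have h11 : (3:ℤ)^q * 5^r * 5^s * 16^n ≤ (5:ℤ)^q * 5^r * 6^s * 32^n := by
    have := show (3:ℤ)^q * 5^r * 5^s * 16^n ≤ (5:ℤ)^q * 5^r * 6^s * 32^n by
      gcongr
      all_goals norm_num
    simpa using this
  have h12 : (2:ℤ)^q * 2^r * 2^s * 16^n ≤ (5:ℤ)^q * 2^r * 2^s * 32^n := by
    have := show (2:ℤ)^q * 2^r * 2^s * 16^n ≤ (5:ℤ)^q * 2^r * 2^s * 32^n by
      gcongr
      all_goals norm_num
    simpa using this
  have h13 : (0:ℤ) ≤ (16:ℤ)^n := by positivity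
  have h14 : (0:ℤ) ≤ (4:ℤ)^q * 2^s * 16^n := by positivity
  have h15 : (0:ℤ) ≤ (4:ℤ)^r * 2^s * 16^n := by positivity
  have h16 : (0:ℤ) ≤ (5:ℤ)^q * 2^r * 2^s * 32^n := by positivity
  have h17 : (0:ℤ) ≤ (2:ℤ)^q * 5^r * 2^s * 32^n := by positivity
  have h18 : (0:ℤ) ≤ (5:ℤ)^q * 5^r * 6^s * 32^n := by positivity
  have h19 : (0:ℤ) ≤ (4:ℤ)^q * 3^r * 4^s * 16^n := by positivity
  have h20 : (0:ℤ) ≤ (5:ℤ)^q * 2^r * 4^s * 16^n := by positivity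
  have h21 : (0:ℤ) ≤ (5:ℤ)^q * 4^r * 6^s * 16^n := by positivity
  have h22 : (0:ℤ) ≤ (3:ℤ)^q * 4^r * 4^s * 16^n := by positivity
  have h23 : (0:ℤ) ≤ (2:ℤ)^q * 5^r * 4^s * 16^n := by positivity
  have h24 : (0:ℤ) ≤ (4:ℤ)^q * 5^r * 6^s * 16^n := by positivity
  unfold G
  simp only [pow_add]
  norm_num
  linarith [h0, h1, h2, h3, h4, h5, h6, h7, h8, h9, h10, h11, h12, h13, h14, h15, h16, h17, h18, h19, h20, h21, h22, h23, h24]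

/-- Node n30 of the certificate tree (half-space node): `0 ≤ G 0 (q + 1) r (s + 1) (n + 1)` — the half-spaces `q ≥ 1`, `r ≥ 1`, `s ≥ 1`, `n ≥ 1` (direction lemmas `G_n30_d*`) and the remaining single point by `norm_num [G]`. -/
theorem G_n30 (q r s n : ℕ) : 0 ≤ G 0 (q + 1) r (s + 1) (n + 1) := by
  by_cases hq : 1 ≤ q
  · obtain ⟨q, rfl⟩ := Nat.exists_eq_add_of_le' hq
    exact G_n30_dq q r s n
  by_cases hr : 1 ≤ r
  · obtain ⟨r, rfl⟩ := Nat.exists_eq_add_of_le' hr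
    exact G_n30_dr q r s n
  by_cases hs : 1 ≤ s
  · obtain ⟨s, rfl⟩ := Nat.exists_eq_add_of_le' hs
    exact G_n30_ds q r s n
  by_cases hn : 1 ≤ n
  · obtain ⟨n, rfl⟩ := Nat.exists_eq_add_of_le' hn
    exact G_n30_dn q r s n
  push Not at hq hr hs hn
  obtain rfl : q = 0 := by omega
  obtain rfl : r = 0 := by omega
  obtain rfl : s = 0 := by omega
  obtain rfl : n = 0 := by omega
  norm_num [G]

/-- Node n24 of the certificate tree (case split on `q`): `0 ≤ G 0 q r (s + 1) (n + 1)` — `q = 0` by `G_n25`, `q ≥ 1` by `G_n30`. -/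
theorem G_n24 (q r s n : ℕ) : 0 ≤ G 0 q r (s + 1) (n + 1) := by
  rcases Nat.eq_zero_or_pos q with h | h
  · subst h
    exact G_n25 r s n
  · obtain ⟨q, rfl⟩ := Nat.exists_eq_add_of_le' h
    exact G_n30 q r s n

/-- Node n31 of the certificate tree (half-space node): `0 ≤ G (p + 1) q r (s + 1) (n + 1)` — the half-spaces `p ≥ 1`, `q ≥ 1`, `r ≥ 1`, `s ≥ 1`, `n ≥ 1` (direction lemmas `G_n31_d*`) and the remaining single point by `norm_num [G]`. -/
theorem G_n31 (p q r s n : ℕ) : 0 ≤ G (p + 1) q r (s + 1) (n + 1) := by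
  by_cases hp : 1 ≤ p
  · obtain ⟨p, rfl⟩ := Nat.exists_eq_add_of_le' hp
    exact G_n31_dp p q r s n
  by_cases hq : 1 ≤ q
  · obtain ⟨q, rfl⟩ := Nat.exists_eq_add_of_le' hq
    exact G_n31_dq p q r s n
  by_cases hr : 1 ≤ r
  · obtain ⟨r, rfl⟩ := Nat.exists_eq_add_of_le' hr
    exact G_n31_dr p q r s n
  by_cases hs : 1 ≤ s
  · obtain ⟨s, rfl⟩ := Nat.exists_eq_add_of_le' hs
    exact G_n31_ds p q r s n
  by_cases hn : 1 ≤ n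
  · obtain ⟨n, rfl⟩ := Nat.exists_eq_add_of_le' hn
    exact G_n31_dn p q r s n
  push Not at hp hq hr hs hn
  obtain rfl : p = 0 := by omega
  obtain rfl : q = 0 := by omega
  obtain rfl : r = 0 := by omega
  obtain rfl : s = 0 := by omega
  obtain rfl : n = 0 := by omega
  norm_num [G]

/-- Node n23 of the certificate tree (case split on `p`): `0 ≤ G p q r (s + 1) (n + 1)` — `p = 0` by `G_n24`, `p ≥ 1` by `G_n31`. -/
theorem G_n23 (p q r s n : ℕ) : 0 ≤ G p q r (s + 1) (n + 1) := by
  rcases Nat.eq_zero_or_pos p with h | h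
  · subst h
    exact G_n24 q r s n
  · obtain ⟨p, rfl⟩ := Nat.exists_eq_add_of_le' h
    exact G_n31 p q r s n

/-- Node n21 of the certificate tree (case split on `n`): `0 ≤ G p q r (s + 1) n` — `n = 0` by `G_n22`, `n ≥ 1` by `G_n23`. -/
theorem G_n21 (p q r s n : ℕ) : 0 ≤ G p q r (s + 1) n := by
  rcases Nat.eq_zero_or_pos n with h | h
  · subst h
    exact G_n22 p q r s
  · obtain ⟨n, rfl⟩ := Nat.exists_eq_add_of_le' h
    exact G_n23 p q r s n

/-- Node n1 of the certificate tree (case split on `s`): `0 ≤ G p q r s n` — `s = 0` by `G_n2`, `s ≥ 1` by `G_n21`. -/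
theorem G_n1 (p q r s n : ℕ) : 0 ≤ G p q r s n := by
  rcases Nat.eq_zero_or_pos s with h | h
  · subst h
    exact G_n2 p q r n
  · obtain ⟨s, rfl⟩ := Nat.exists_eq_add_of_le' h
    exact G_n21 p q r s n

/-- **`G ≥ 0` on `ℕ⁵`**: (★) holds on every star gadget with hub leaves and any number of pure pairs `P[xc|xc]`. -/
theorem G_nonneg (p q r s n : ℕ) : 0 ≤ G p q r s n := G_n1 p q r s n

end PercRepro.StarGadget
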